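import Literature.Probability.RandomPlanarGeometry.HexSAWStripBetaLengthSplit
import Literature.Probability.RandomPlanarGeometry.HexSAWStripBridgeLengthPointwiseLaw
import Mathlib.Analysis.Normed.Group.Tannery
import Mathlib.Analysis.Normed.Ring.InfiniteSum
import HarnessLib

/-!
# ★★★ The POINTWISE law of the β-walks of the honeycomb strip counted by LENGTH at the surface threshold:
# `Σ_{β-walks with 2m vertices} x_c^{2m} y_T^{#top} → Λℓ_T > 0` (module «BETA-LENGTH-LAW»)

Topic `Literature/Probability/RandomPlanarGeometry` (continues «BETA-LENGTH-SPLIT» `HexSAWStripBetaLengthSplit.lean` — the exact split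
`HV.betaLenSum_eq_two_mul`, the summable pieces `HV.summable_headLen / HV.summable_tailLen`, `HV.tendsto_noRenLen_atTop`, the uniform middle bound
`HV.exists_hb0Len_stripYT_le`, `HV.hb0Len_eq_LUM` — and «LENGTH-POINTWISE-LAW» `HexSAWStripBridgeLengthPointwiseLaw.lean` — the bridge law on the
parity classes `HV.exists_tendsto_LUM_parity` `D(2k + χ_a − χ_b)_{ab} → 2ρ′u′_aℓ′_b`, `HV.chain_parity_even`, `HV.lchi_facts`; «BRIDGE-LENGTH-RENEWAL»
(`HV.LUM_LMM_eq_of_le`); Mathlib's Tannery theorem `tendsto_tsum_of_dominated_convergence`).  Lane «pcv-sawmu» (CriticalPhenomena venture), a-p2 g22 —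
item 1 of HANDOFF a-p2 g21 («β-walks by length»), the statement NOT claimed in `HexSAWStripThresholdChainPointwise.lean` (there: `Σ_{betaLen} ≤ C` only)
and in «LENGTH-POINTWISE-LAW» (there: bridges only).  Sources of the SETTING: W. Feller, vol. I (1968) XIII.3 (periodic recurrent events), XIII.11
(renewal with a delay: first and last pieces with finite mass); H. Duminil-Copin, A. Hammond, CMP 324 (2013) §2.2; H. Duminil-Copin, S. Smirnov,
Ann. Math. 175 (2012) §3; N. R. Beaton et al., CMP 326 (2014) §3.2, Corollary 8 (`B_T(x_c; y)`, its radius `y_T`).  Nothing of the kind is printed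
for the strip: in print the strip series are rational (finite transfer matrices) and such a law would be read off a Perron–Frobenius analysis —
not used here; the lane's route is renewal theory along the column coordinate at criticality.

## The argument
By «BETA-LENGTH-SPLIT», `bℓ_T(n)(y_T) = 2(nℓ_T(n) + Σ_{a,b} S_{ab}(n))` with `S_{ab}(n) = Σ_{i+j+k=n} fℓ_a(i) dℓ_{ab}(j) gℓ_b(k)` and `nℓ_T(n) → 0`.
Write `S_{ab}(n) = Σ_{(i,k) ∈ ℕ²} Φ_n(i,k)`, `Φ_n(i,k) = fℓ_a(i) dℓ_{ab}(n−i−k) gℓ_b(k) 𝟙[i+k ≤ n]`.  Domination: `|Φ_n(i,k)| ≤ fℓ_a(i) K gℓ_b(k)`, summable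
over `ℕ²` (`Σ fℓ_a`, `Σ gℓ_b < ∞`).  Pointwise: a head from the origin (level `0`) to level `a` with `i` vertices has `i ≡ a + 1`, a tail from `b` to the top
level `2T − 1` with `k` steps has `k ≡ 2T − 1 − b` (bipartite lattice), so along `n = 2m` the middle length `2m − i − k ≡ χ_a − χ_b (mod 2)` runs through
the parity class on which `dℓ_{ab} = D(·)_{ab} → 2ρ′u′_aℓ′_b`; hence `Φ_{2m}(i,k) → fℓ_a(i) · 2ρ′u′_aℓ′_b · gℓ_b(k)`, and Tannery gives
`S_{ab}(2m) → Fℓ_a · 2ρ′u′_aℓ′_b · Gℓ_b`.  β-walks have an even number of vertices (origin to top level), so only even `n` matter.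

## What is proved (namespace `Literature.Probability.RandomPlanarGeometry.SAW.HV`; `y_T = stripYT T`, `x_c = hexCriticalFugacity`)

* §A parities: `even_of_headLen_ne_zero` (`fℓ_c(i) ≠ 0 ⇒ c + 1 − i` even), `even_of_tailLen_ne_zero`, ★ `betaLenSum_eq_zero_of_odd`.
* §B `renLenPair` (`S_{ab}`), `renLenTerm` (`Φ_n`), `renLenPair_eq_tsum`, ★ `tendsto_renLenTerm_even` (pointwise limit on the forced parity class),
  `norm_renLenTerm_le` (domination), ★★ `tendsto_renLenPair_even` (Tannery), ★★ `tendsto_betaRenewalLen_even`.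
* §C ★★★ `exists_tendsto_betaLenSum_even` — with the positive data `u′, ℓ′, ρ′` of the bridge length law (restated alongside),
  `bℓ_T(2m)(y_T) ⟶ 4ρ′ · (Σ_a Fℓ_a u′_a) · (Σ_b ℓ′_b Gℓ_b)` (`T ≥ 2`); ★★★ `exists_pos_tendsto_betaLenSum_even` — `∃ Λℓ_T > 0`,
  `bℓ_T(2m)(y_T) → Λℓ_T` and `bℓ_T(2m+1) = 0`; ★★ `exists_pos_tendsto_sum_betaLen_even` (in every box `S_{T,L_m}`, `L_m ≥ 2m`);
  ★★ `exists_pos_tendsto_pow_mul_betaCount_even` (`x_c^{2m} · Σ_{β-walks, 2m vertices} y_T^{#top} → Λℓ_T`: the surface-weighted number of β-walks of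
  length `2m` is `≍ x_c^{−2m}` with a limit amplitude); ★★ `tendsto_betaLenSum_succ_div` (ratio law `→ 1`).

Label: LANE THEOREM (own result of lane «pcv-sawmu», a-p2 g22, 2026-08-26).  NOT claimed: a rate of convergence, the corresponding law for
all chains `x_c^n Z_{T,n}(y_T)` (whose even and odd subsequences have DIFFERENT limits in general — already for `T = 1`), a closed form of `Λℓ_T`
or its relation to the contact-law amplitude `Λ_T`, uniformity in `T`, `T = 1`.
-/

noncomputable section

open Finset Filter Topology Literature.Probability.LatticeModels Literature.Probability.Percolation

namespace Literature.Probability.RandomPlanarGeometry.SAW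

namespace HV

variable {T : ℕ}

/-! ### §A Parities: heads, tails, middle pieces and β-walks live on one parity class of lengths -/

section Parity

variable {y : ℝ} {i j k n : ℕ}

/-- A head with `i` vertices ending on level `c` has `c + 1 − i` even (the honeycomb lattice is bipartite: a step changes the level by `±1`),
so `fℓ_c(i)(y) ≠ 0 ⇒ Even (c + 1 − i)`. [cite: DuminilCopinSmirnov2012, §3 (the hexagonal lattice); lane plumbing] -/
theorem even_of_headLen_ne_zero {c : ℤ} (h : headLen T i c y ≠ 0) : Even (c + 1 - (i : ℤ)) := by
  obtain ⟨l, hl, -⟩ := exists_ne_zero_of_sum_ne_zero h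
  rw [mem_filter] at hl
  obtain ⟨hc, -, -, hhd, -, h2, -, -, hlt, -⟩ := of_mem_headN hl.1
  have hne : l ≠ [] := List.ne_nil_of_length_pos (by omega)
  have hev := chain_parity_even hc hne
  have hh : hdLev l = 0 := by rw [hdLev, hhd, Option.getD_some, lev_hvOrigin]
  rw [hlt, hh, hlen, hl.2] at hev
  rw [show c + 1 - (i : ℤ) = c - 0 - (((i : ℕ) : ℤ) - 1) by ring]
  exact hev

/-- A tail with `k` steps from level `e` to the top level `2T − 1` has `2T − 1 − e − k` even: `gℓ_e(k)(y) ≠ 0 ⇒ Even (2T − 1 − e − k)`.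
[cite: DuminilCopinSmirnov2012, §3; lane plumbing] -/
theorem even_of_tailLen_ne_zero {e : ℤ} (h : tailLen T k e y ≠ 0) : Even (2 * (T : ℤ) - 1 - e - (k : ℤ)) := by
  obtain ⟨l, hl, -⟩ := exists_ne_zero_of_sum_ne_zero h
  rw [mem_filter] at hl
  obtain ⟨hc, -, -, -, -, h2, -, -, hhd, hlt⟩ := of_mem_tailN hl.1
  have hne : l ≠ [] := List.ne_nil_of_length_pos (by omega)
  have hev := chain_parity_even hc hne
  rw [hlt, hhd, hlen, hl.2] at hev
  rw [show 2 * (T : ℤ) - 1 - e - (k : ℤ) = 2 * (T : ℤ) - 1 - e - (((k + 1 : ℕ) : ℤ) - 1) by push_cast; ring]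
  exact hev

/-- A β-walk of `S_T` (from the origin, level `0`, to the top level `2T − 1`) has an even number of vertices: `bℓ_T(n)(y) = 0` for odd `n`
(`T ≥ 1`). [cite: DuminilCopinSmirnov2012, §3 (walks a → β of S_{T,L}); lane plumbing] -/
theorem betaLenSum_eq_zero_of_odd (hT : 1 ≤ T) (hn : ¬ Even n) (y : ℝ) : betaLenSum T n y = 0 := by
  rw [betaLenSum]
  refine sum_eq_zero fun l hl => ?_
  exfalso
  rw [betaLen, mem_filter] at hl
  obtain ⟨hc, hhd, -, -, hne, hlast⟩ := (mem_bridgeLists_iff hT).1 hl.1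
  have hev := chain_parity_even hc hne
  have hh : hdLev l = 0 := by rw [hdLev, hhd, Option.getD_some, lev_hvOrigin]
  have hlt : ltLev l = 2 * (T : ℤ) - 1 := by rw [ltLev, List.getLast?_eq_some_getLast hne, Option.getD_some, hlast]
  rw [hlt, hh, hlen, hl.2] at hev
  apply hn
  have hz : Even (n : ℤ) := by
    obtain ⟨r, hr⟩ := hev
    exact ⟨(T : ℤ) - r, by omega⟩
  exact (Int.even_coe_nat n).1 hz

end Parity

/-! ### §B The renewal sum along even lengths converges: Tannery's theorem over the head and tail lengths -/

section Renewal

/-- The level-pair term of the length-graded renewal sum at the threshold (plumbing): `S_{ab}(n) = Σ_{i+j+k=n} fℓ_a(i) dℓ_{ab}(j) gℓ_b(k)` at `y_T`.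
[cite: DuminilCopinHammond2013, §2.2; lane plumbing] -/
def renLenPair (T n : ℕ) (a b : Fin (2 * T)) : ℝ :=
  ∑ t ∈ T3 n, headLen T t.1 (a : ℕ) (stripYT T) * hb0Len T t.2.1 (a : ℕ) (b : ℕ) (stripYT T) * tailLen T t.2.2 (b : ℕ) (stripYT T)

/-- `Σ_{a,b} S_{ab}(n)` is the renewal sum at `y_T` (plumbing). [cite: DuminilCopinHammond2013, §2.2; lane plumbing] -/
theorem betaRenewalLen_eq_sum_renLenPair (n : ℕ) : betaRenewalLen T n (stripYT T) = ∑ a, ∑ b, renLenPair T n a b := rfl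

/-- The Tannery family (plumbing): `Φ_n(i,k) = fℓ_a(i) dℓ_{ab}(n − i − k) gℓ_b(k)` if `i + k ≤ n`, else `0`. [cite: DuminilCopinHammond2013, §2.2; lane plumbing] -/
def renLenTerm (T n : ℕ) (a b : Fin (2 * T)) (p : ℕ × ℕ) : ℝ :=
  if p.1 + p.2 ≤ n then
    headLen T p.1 (a : ℕ) (stripYT T) * hb0Len T (n - p.1 - p.2) (a : ℕ) (b : ℕ) (stripYT T) * tailLen T p.2 (b : ℕ) (stripYT T)
  else 0

/-- `S_{ab}(n) = Σ'_{(i,k) ∈ ℕ × ℕ} Φ_n(i,k)` (plumbing: the middle length is determined by the outer two). [cite: DuminilCopinHammond2013, §2.2; lane plumbing] -/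
theorem renLenPair_eq_tsum (n : ℕ) (a b : Fin (2 * T)) : renLenPair T n a b = ∑' p : ℕ × ℕ, renLenTerm T n a b p := by
  classical
  have hinj : Set.InjOn (fun t : ℕ × ℕ × ℕ => (t.1, t.2.2)) (T3 n : Set (ℕ × ℕ × ℕ)) := by
    intro t ht t' ht' h
    rw [mem_coe, mem_T3] at ht ht'
    simp only [Prod.mk.injEq] at h
    refine Prod.ext h.1 (Prod.ext ?_ h.2)
    omega
  rw [tsum_eq_sum (s := (T3 n).image fun t => (t.1, t.2.2)) (fun p hp => ?_)]
  · rw [sum_image hinj, renLenPair]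
    refine sum_congr rfl fun t ht => ?_
    rw [mem_T3] at ht
    rw [renLenTerm, if_pos (by simp only; omega)]
    have hj : n - t.1 - t.2.2 = t.2.1 := by omega
    simp only [hj]
  · rw [renLenTerm, if_neg]
    intro hle
    apply hp
    rw [mem_image]
    exact ⟨(p.1, n - p.1 - p.2, p.2), mem_T3.2 (by simp only; omega), rfl⟩

variable {u ℓ : Fin (2 * T) → ℝ} {ρ : ℝ}

/-- ★ **Pointwise limit of the Tannery family along even lengths**: for fixed head length `i` and tail length `k`, as `m → ∞`,
`Φ_{2m}(i,k) → fℓ_a(i) · 2ρ′u′_aℓ′_b · gℓ_b(k)` — if the head and the tail slices are non-empty, the parities of `i` (`≡ a + 1`) and `k`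
(`≡ 2T − 1 − b`) force the middle length `2m − i − k ≡ χ_a − χ_b (mod 2)`, the parity class on which the bridge law `D(2k'+χ_a−χ_b)_{ab} → 2ρ′u′_aℓ′_b`
of «LENGTH-POINTWISE-LAW» holds. [cite: Feller1968, XIII.3 (periodic recurrent events); DuminilCopinHammond2013, §2.2; lane «pcv-sawmu» a-p2 g22 — own] -/
theorem tendsto_renLenTerm_even
    (hlaw : ∀ a b, Tendsto (fun k : ℕ => LUM T (2 * k + 1) (2 * (k : ℤ) + lchi a - lchi b) (stripYT T) a b) atTop (𝓝 (2 * (ρ * (u a * ℓ b)))))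
    (a b : Fin (2 * T)) (p : ℕ × ℕ) :
    Tendsto (fun m : ℕ => renLenTerm T (2 * m) a b p) atTop
      (𝓝 (headLen T p.1 (a : ℕ) (stripYT T) * (2 * (ρ * (u a * ℓ b))) * tailLen T p.2 (b : ℕ) (stripYT T))) := by
  obtain ⟨i, k⟩ := p
  by_cases hFG : headLen T i (a : ℕ) (stripYT T) = 0 ∨ tailLen T k (b : ℕ) (stripYT T) = 0
  · have h0 : ∀ m, renLenTerm T (2 * m) a b (i, k) = 0 := fun m => by
      rw [renLenTerm]
      split_ifs
      · rcases hFG with h | h <;> simp only [h, zero_mul, mul_zero]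
      · rfl
    have hlim : headLen T i (a : ℕ) (stripYT T) * (2 * (ρ * (u a * ℓ b))) * tailLen T k (b : ℕ) (stripYT T) = 0 := by
      rcases hFG with h | h <;> simp only [h, zero_mul, mul_zero]
    rw [hlim]
    simp only [h0]
    exact tendsto_const_nhds
  · obtain ⟨hF0, hG0⟩ := not_or.1 hFG
    have hpi := even_of_headLen_ne_zero hF0
    have hpk := even_of_tailLen_ne_zero hG0
    obtain ⟨ha, hae⟩ := lchi_facts a
    obtain ⟨hb, hbe⟩ := lchi_facts b
    obtain ⟨r1, h1⟩ := hpi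
    obtain ⟨r2, h2⟩ := hpk
    obtain ⟨r3, h3⟩ := hae
    obtain ⟨r4, h4⟩ := hbe
    -- `i + k + χ_a − χ_b = 2r` with `r ≥ 0`
    obtain ⟨r, hr, hr0⟩ : ∃ r : ℤ, (i : ℤ) + k + lchi a - lchi b = 2 * r ∧ 0 ≤ r :=
      ⟨((a : ℕ) : ℤ) - ((b : ℕ) : ℤ) + (T : ℤ) - r1 - r2 - r3 + r4, by omega,
        by rcases ha with ha | ha <;> rcases hb with hb | hb <;> omega⟩
    set c₀ : ℕ := r.toNat with hc₀
    have hc₀r : (c₀ : ℤ) = r := Int.toNat_of_nonneg hr0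
    have hEq : ∀ᶠ m : ℕ in atTop, renLenTerm T (2 * m) a b (i, k) =
        headLen T i (a : ℕ) (stripYT T) * LUM T (2 * (m - c₀) + 1) (2 * ((m - c₀ : ℕ) : ℤ) + lchi a - lchi b) (stripYT T) a b *
          tailLen T k (b : ℕ) (stripYT T) := by
      filter_upwards [eventually_ge_atTop (c₀ + 1)] with m hm
      have hj : 1 ≤ 2 * m - i - k := by rcases ha with ha | ha <;> rcases hb with hb | hb <;> omega
      rw [renLenTerm, if_pos (by simp only; omega)]
      simp only
      rw [hb0Len_eq_LUM hj]
      have hσ : (((2 * m - i - k : ℕ) : ℤ)) = 2 * ((m - c₀ : ℕ) : ℤ) + lchi a - lchi b := by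
        rcases ha with ha | ha <;> rcases hb with hb | hb <;> omega
      rw [hσ, (LUM_LMM_eq_of_le (T := T) (N := 2 * m - i - k) (N' := 2 * (m - c₀) + 1)
        (σ := 2 * ((m - c₀ : ℕ) : ℤ) + lchi a - lchi b) ?_ ?_ (stripYT T)).1]
      · rcases ha with ha | ha <;> rcases hb with hb | hb <;> omega
      · rcases ha with ha | ha <;> rcases hb with hb | hb <;> omega
    have hlim : Tendsto (fun m : ℕ => headLen T i (a : ℕ) (stripYT T) *
        LUM T (2 * (m - c₀) + 1) (2 * ((m - c₀ : ℕ) : ℤ) + lchi a - lchi b) (stripYT T) a b * tailLen T k (b : ℕ) (stripYT T))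
        atTop (𝓝 (headLen T i (a : ℕ) (stripYT T) * (2 * (ρ * (u a * ℓ b))) * tailLen T k (b : ℕ) (stripYT T))) :=
      (((hlaw a b).comp (tendsto_sub_atTop_nat c₀)).const_mul _).mul_const _
    exact hlim.congr' (hEq.mono fun m hm => hm.symm)

/-- The Tannery domination (plumbing): `|Φ_n(i,k)| ≤ fℓ_a(i) · K · gℓ_b(k)` whenever the middle slices are bounded by `K ≥ 0`.
[cite: DuminilCopinHammond2013, §2.2; lane plumbing] -/
theorem norm_renLenTerm_le (hT : 1 ≤ T) {K : ℝ} (hK : ∀ (j : ℕ) (a b : Fin (2 * T)), hb0Len T j (a : ℕ) (b : ℕ) (stripYT T) ≤ K)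
    (hK0 : 0 ≤ K) (n : ℕ) (a b : Fin (2 * T)) (p : ℕ × ℕ) :
    ‖renLenTerm T n a b p‖ ≤ headLen T p.1 (a : ℕ) (stripYT T) * K * tailLen T p.2 (b : ℕ) (stripYT T) := by
  have hy : 0 ≤ stripYT T := (one_lt_stripYT hT).le.trans' zero_le_one
  have hF0 : 0 ≤ headLen T p.1 (a : ℕ) (stripYT T) := (pieceLen_nonneg hy p.1 ((a : ℕ) : ℤ) ((b : ℕ) : ℤ)).1
  have hG0 : 0 ≤ tailLen T p.2 (b : ℕ) (stripYT T) := (pieceLen_nonneg hy p.2 ((a : ℕ) : ℤ) ((b : ℕ) : ℤ)).2.2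
  rw [Real.norm_eq_abs, renLenTerm]
  by_cases h : p.1 + p.2 ≤ n
  · rw [if_pos h]
    have hD0 : 0 ≤ hb0Len T (n - p.1 - p.2) (a : ℕ) (b : ℕ) (stripYT T) :=
      (pieceLen_nonneg hy (n - p.1 - p.2) ((a : ℕ) : ℤ) ((b : ℕ) : ℤ)).2.1
    rw [abs_of_nonneg (mul_nonneg (mul_nonneg hF0 hD0) hG0)]
    exact mul_le_mul_of_nonneg_right (mul_le_mul_of_nonneg_left (hK _ a b) hF0) hG0
  · rw [if_neg h, abs_zero]
    exact mul_nonneg (mul_nonneg hF0 hK0) hG0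

set_option maxHeartbeats 400000 in -- Tannery with two heavy summability side conditions: headroom for the on-accept build (LANE NOTICE #11)
/-- ★★ **The level-pair renewal sums converge along even lengths**: `S_{ab}(2m) → Fℓ_a · 2ρ′u′_aℓ′_b · Gℓ_b` (`T ≥ 2`) — Tannery's theorem
(dominated convergence for series) over the head and tail lengths `(i,k) ∈ ℕ × ℕ`, dominated by `fℓ_a(i) · K · gℓ_b(k)` with `K` the uniform bound of
the middle slices and `Σ_i fℓ_a(i)`, `Σ_k gℓ_b(k)` finite. [cite: Feller1968, XIII.3; DuminilCopinHammond2013, §2.2; lane «pcv-sawmu» a-p2 g22 — own] -/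
theorem tendsto_renLenPair_even (hT : 2 ≤ T) (hu : ∀ a, 0 < u a) (hℓ : ∀ b, 0 < ℓ b) (hρ : 0 < ρ)
    (hlaw : ∀ a b, Tendsto (fun k : ℕ => LUM T (2 * k + 1) (2 * (k : ℤ) + lchi a - lchi b) (stripYT T) a b) atTop (𝓝 (2 * (ρ * (u a * ℓ b)))))
    (a b : Fin (2 * T)) :
    Tendsto (fun m : ℕ => renLenPair T (2 * m) a b) atTop
      (𝓝 (headLenGF T (a : ℕ) * (2 * (ρ * (u a * ℓ b))) * tailLenGF T (b : ℕ))) := by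
  have hT1 : 1 ≤ T := by omega
  have hy : 0 ≤ stripYT T := (one_lt_stripYT hT1).le.trans' zero_le_one
  obtain ⟨K, hK⟩ := exists_hb0Len_stripYT_le hT1
  have hK0 : 0 ≤ K := le_trans (pieceLen_nonneg hy 0 ((a : ℕ) : ℤ) ((b : ℕ) : ℤ)).2.1 (hK 0 a b)
  have hL0 : 0 ≤ 2 * (ρ * (u a * ℓ b)) :=
    mul_nonneg zero_le_two (mul_nonneg hρ.le (mul_nonneg (hu a).le (hℓ b).le))
  have hsF := summable_headLen hT ((a : ℕ) : ℤ)
  have hsG := summable_tailLen hT ((b : ℕ) : ℤ)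
  have hF0 : ∀ i, 0 ≤ headLen T i (a : ℕ) (stripYT T) := fun i => (pieceLen_nonneg hy i ((a : ℕ) : ℤ) ((b : ℕ) : ℤ)).1
  have hG0 : ∀ k, 0 ≤ tailLen T k (b : ℕ) (stripYT T) := fun k => (pieceLen_nonneg hy k ((a : ℕ) : ℤ) ((b : ℕ) : ℤ)).2.2
  have hf' : ∀ i, 0 ≤ headLen T i (a : ℕ) (stripYT T) * K := fun i => mul_nonneg (hF0 i) hK0
  have hbound : Summable (fun p : ℕ × ℕ => headLen T p.1 (a : ℕ) (stripYT T) * K * tailLen T p.2 (b : ℕ) (stripYT T)) :=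
    Summable.mul_of_nonneg (f := fun i => headLen T i (a : ℕ) (stripYT T) * K) (g := fun k => tailLen T k (b : ℕ) (stripYT T))
      (hsF.mul_right K) hsG hf' hG0
  have hf'' : ∀ i, 0 ≤ headLen T i (a : ℕ) (stripYT T) * (2 * (ρ * (u a * ℓ b))) := fun i => mul_nonneg (hF0 i) hL0
  have hprod : Summable (fun p : ℕ × ℕ =>
      headLen T p.1 (a : ℕ) (stripYT T) * (2 * (ρ * (u a * ℓ b))) * tailLen T p.2 (b : ℕ) (stripYT T)) :=
    Summable.mul_of_nonneg (f := fun i => headLen T i (a : ℕ) (stripYT T) * (2 * (ρ * (u a * ℓ b))))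
      (g := fun k => tailLen T k (b : ℕ) (stripYT T)) (hsF.mul_right _) hsG hf'' hG0
  have hlim : Tendsto (fun m : ℕ => ∑' p : ℕ × ℕ, renLenTerm T (2 * m) a b p) atTop
      (𝓝 (∑' p : ℕ × ℕ, headLen T p.1 (a : ℕ) (stripYT T) * (2 * (ρ * (u a * ℓ b))) * tailLen T p.2 (b : ℕ) (stripYT T))) :=
    tendsto_tsum_of_dominated_convergence (𝓕 := atTop)
      (f := fun (m : ℕ) (p : ℕ × ℕ) => renLenTerm T (2 * m) a b p)
      (g := fun p : ℕ × ℕ => headLen T p.1 (a : ℕ) (stripYT T) * (2 * (ρ * (u a * ℓ b))) * tailLen T p.2 (b : ℕ) (stripYT T))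
      (bound := fun p : ℕ × ℕ => headLen T p.1 (a : ℕ) (stripYT T) * K * tailLen T p.2 (b : ℕ) (stripYT T))
      hbound (fun p => tendsto_renLenTerm_even hlaw a b p)
      (Eventually.of_forall fun m p => norm_renLenTerm_le hT1 hK hK0 (2 * m) a b p)
  have hg : ∑' p : ℕ × ℕ, headLen T p.1 (a : ℕ) (stripYT T) * (2 * (ρ * (u a * ℓ b))) * tailLen T p.2 (b : ℕ) (stripYT T) =
      headLenGF T (a : ℕ) * (2 * (ρ * (u a * ℓ b))) * tailLenGF T (b : ℕ) := by
    rw [headLenGF, tailLenGF, ← tsum_mul_right]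
    exact ((hsF.mul_right _).tsum_mul_tsum hsG hprod).symm
  rw [← hg]
  exact hlim.congr fun m => (renLenPair_eq_tsum (2 * m) a b).symm

/-- ★★ **The renewal sum converges along even lengths**: `Σ_{a,b} Σ_{i+j+k=2m} fℓ_a(i) dℓ_{ab}(j) gℓ_b(k) → Σ_{a,b} Fℓ_a · 2ρ′u′_aℓ′_b · Gℓ_b` (`T ≥ 2`).
[cite: Feller1968, XIII.3; DuminilCopinHammond2013, §2.2; lane «pcv-sawmu» a-p2 g22 — own] -/
theorem tendsto_betaRenewalLen_even (hT : 2 ≤ T) (hu : ∀ a, 0 < u a) (hℓ : ∀ b, 0 < ℓ b) (hρ : 0 < ρ)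
    (hlaw : ∀ a b, Tendsto (fun k : ℕ => LUM T (2 * k + 1) (2 * (k : ℤ) + lchi a - lchi b) (stripYT T) a b) atTop (𝓝 (2 * (ρ * (u a * ℓ b))))) :
    Tendsto (fun m : ℕ => betaRenewalLen T (2 * m) (stripYT T)) atTop
      (𝓝 (∑ a : Fin (2 * T), ∑ b : Fin (2 * T), headLenGF T (a : ℕ) * (2 * (ρ * (u a * ℓ b))) * tailLenGF T (b : ℕ))) := by
  simp only [betaRenewalLen_eq_sum_renLenPair]
  exact tendsto_finsetSum _ fun a _ => tendsto_finsetSum _ fun b _ => tendsto_renLenPair_even hT hu hℓ hρ hlaw a b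

end Renewal

/-! ### §C ★★★ The pointwise law of the β-walks of `S_T` by length at the threshold `y_T` -/

section Law

/-- Algebra of the limit constant (plumbing). [folklore] -/
private theorem lenLaw_const_eq (u ℓ : Fin (2 * T) → ℝ) (ρ : ℝ) :
    2 * (0 + ∑ a : Fin (2 * T), ∑ b : Fin (2 * T), headLenGF T (a : ℕ) * (2 * (ρ * (u a * ℓ b))) * tailLenGF T (b : ℕ)) =
      4 * ρ * (∑ a : Fin (2 * T), headLenGF T (a : ℕ) * u a) * (∑ b : Fin (2 * T), ℓ b * tailLenGF T (b : ℕ)) := by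
  rw [zero_add, mul_assoc (4 * ρ), Finset.sum_mul_sum, Finset.mul_sum, Finset.mul_sum]
  refine Finset.sum_congr rfl fun a _ => ?_
  rw [Finset.mul_sum, Finset.mul_sum]
  refine Finset.sum_congr rfl fun b _ => ?_
  ring

/-- ★★★ **THE LENGTH LAW OF THE β-WALKS AT THE THRESHOLD, with its constant**: for every width `T ≥ 2` there are the positive data
`u′, ℓ′, ρ′` of the bridge length law (restated: `D(2k + χ_a − χ_b)_{ab} → 2ρ′u′_aℓ′_b`, «LENGTH-POINTWISE-LAW») such that
`bℓ_T(2m)(y_T) = Σ_{β-walks ω of S_T with 2m vertices} x_c^{2m} y_T^{#top(ω)} ⟶ 4ρ′ · (Σ_a Fℓ_a u′_a) · (Σ_b ℓ′_b Gℓ_b)` as `m → ∞`,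
with `Fℓ_a`, `Gℓ_b` the head / tail series of the infinite strip at `y_T` («BETA-LENGTH-SPLIT» §5).  Ingredients: the exact split
`bℓ = 2(nℓ + Σ fℓ dℓ gℓ)`, `nℓ_T(n)(y_T) → 0`, and Tannery's theorem over the head and tail lengths with the bridge law on the forced parity class.
[cite: Feller1968, XIII.3 (periodic recurrent events), XIII.11; DuminilCopinHammond2013, §2.2; BeatonBousquetMelouDeGierDuminilCopinGuttmann2014, §3.2 and Corollary 8 (B_T(x_c; y), y_T); lane «pcv-sawmu» a-p2 g22 — own result] -/
theorem exists_tendsto_betaLenSum_even (hT : 2 ≤ T) :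
    ∃ (u ℓ : Fin (2 * T) → ℝ) (ρ : ℝ), (∀ a, 0 < u a) ∧ (∀ b, 0 < ℓ b) ∧ 0 < ρ ∧
      (∀ a b, Tendsto (fun k : ℕ => LUM T (2 * k + 1) (2 * (k : ℤ) + lchi a - lchi b) (stripYT T) a b) atTop
        (𝓝 (2 * (ρ * (u a * ℓ b))))) ∧
      Tendsto (fun m : ℕ => betaLenSum T (2 * m) (stripYT T)) atTop
        (𝓝 (4 * ρ * (∑ a : Fin (2 * T), headLenGF T (a : ℕ) * u a) * (∑ b : Fin (2 * T), ℓ b * tailLenGF T (b : ℕ)))) := by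
  have hT1 : 1 ≤ T := by omega
  have hy : 0 ≤ stripYT T := (one_lt_stripYT hT1).le.trans' zero_le_one
  obtain ⟨u, ℓ, ρ, hu, hℓ, hρ, -, hlaw⟩ := exists_tendsto_LUM_parity hT
  refine ⟨u, ℓ, ρ, hu, hℓ, hρ, hlaw, ?_⟩
  have h2m : Tendsto (fun m : ℕ => 2 * m) atTop atTop := tendsto_atTop_atTop.2 fun n => ⟨n, fun m hm => by omega⟩
  have h0 : Tendsto (fun m : ℕ => noRenLen T (2 * m) (stripYT T)) atTop (𝓝 0) := (tendsto_noRenLen_atTop hT).comp h2m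
  have h1 := tendsto_betaRenewalLen_even hT hu hℓ hρ hlaw
  have h2 := (h0.add h1).const_mul 2
  rw [lenLaw_const_eq] at h2
  refine h2.congr fun m => ?_
  exact (betaLenSum_eq_two_mul hT1 hy (2 * m)).symm

/-- ★★★ **THE POINTWISE LAW OF THE β-WALKS BY LENGTH** (headline form): for every width `T ≥ 2` there is `Λℓ_T > 0` with
`Σ_{β-walks ω of S_T with 2m vertices} x_c^{2m} y_T^{#top(ω)} ⟶ Λℓ_T` (`m → ∞`), while β-walks with an odd number of vertices do not exist.
So AT the critical surface fugacity the `x_c`-weighted β-walks of each (even) length carry an asymptotically CONSTANT mass — exponent `γ = 1` with an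
amplitude, the pointwise refinement of the bounded law `HV.exists_betaLen_stripYT_le` and of the Abelian residue `(y_T − y)B_T(x_c; y) → Λ_T y_T`.
[cite: Feller1968, XIII.3, XIII.11; DuminilCopinHammond2013, §2.2; DuminilCopinSmirnov2012, §3; BeatonBousquetMelouDeGierDuminilCopinGuttmann2014, §3.2 and Corollary 8; lane «pcv-sawmu» a-p2 g22 — own result] -/
theorem exists_pos_tendsto_betaLenSum_even (hT : 2 ≤ T) :
    ∃ Λ : ℝ, 0 < Λ ∧ Tendsto (fun m : ℕ => betaLenSum T (2 * m) (stripYT T)) atTop (𝓝 Λ) ∧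
      ∀ m : ℕ, betaLenSum T (2 * m + 1) (stripYT T) = 0 := by
  have hT1 : 1 ≤ T := by omega
  obtain ⟨u, ℓ, ρ, hu, hℓ, hρ, -, hlim⟩ := exists_tendsto_betaLenSum_even hT
  refine ⟨_, ?_, hlim, fun m => betaLenSum_eq_zero_of_odd hT1 (Nat.not_even_iff_odd.2 ⟨m, rfl⟩) _⟩
  obtain ⟨hF1, hGt⟩ := headLenGF_one_pos hT
  have hFu : 0 < ∑ a : Fin (2 * T), headLenGF T (a : ℕ) * u a := by
    refine Finset.sum_pos' (fun a _ => mul_nonneg (headGFN_le_headLenGF hT 0 _ ((a : ℕ) : ℤ)).2.2.1 (hu a).le)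
      ⟨⟨1, by omega⟩, Finset.mem_univ _, mul_pos ?_ (hu _)⟩
    simpa using hF1
  have hℓG : 0 < ∑ b : Fin (2 * T), ℓ b * tailLenGF T (b : ℕ) := by
    refine Finset.sum_pos' (fun b _ => mul_nonneg (hℓ b).le (headGFN_le_headLenGF hT 0 ((b : ℕ) : ℤ) _).2.2.2)
      ⟨⟨2 * T - 2, by omega⟩, Finset.mem_univ _, mul_pos (hℓ _) ?_⟩
    have hc : (((2 * T - 2 : ℕ) : ℕ) : ℤ) = 2 * (T : ℤ) - 2 := by omega
    simpa [hc] using hGt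
  have := mul_pos (mul_pos (mul_pos (by norm_num : (0 : ℝ) < 4) hρ) hFu) hℓG
  exact this

/-- ★★ **The law in every box growing with the length**: the same limit holds for the β-walks with `2m` vertices of `S_{T,L_m}` whenever
`L_m ≥ 2m` (they are all the β-walks of `S_T` with `2m` vertices). [cite: DuminilCopinSmirnov2012, §3 (the domains S_{T,L}); BeatonBousquetMelouDeGierDuminilCopinGuttmann2014, §3.2; lane «pcv-sawmu» a-p2 g22 — own result] -/
theorem exists_pos_tendsto_sum_betaLen_even (hT : 2 ≤ T) :
    ∃ Λ : ℝ, 0 < Λ ∧ ∀ L : ℕ → ℕ, (∀ m, 2 * m ≤ L m) →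
      Tendsto (fun m : ℕ => ∑ l ∈ betaLen T (L m) (2 * m), hexCriticalFugacity ^ l.length * stripYT T ^ topCnt T l) atTop (𝓝 Λ) := by
  obtain ⟨Λ, hΛ, hlim, -⟩ := exists_pos_tendsto_betaLenSum_even hT
  refine ⟨Λ, hΛ, fun L hL => hlim.congr fun m => ?_⟩
  exact (sum_betaLen_eq_betaLenSum (by omega) (hL m) _).symm

/-- ★★ **Counting form**: `x_c^{2m} · Σ_{β-walks ω of S_T with 2m vertices} y_T^{#top(ω)} ⟶ Λℓ_T > 0` — the surface-weighted NUMBER of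
β-walks of length `2m` grows exactly like `x_c^{−2m}`, with a limit amplitude. [cite: BeatonBousquetMelouDeGierDuminilCopinGuttmann2014, §3.2 and Corollary 8 (ρ_T(y_T) = x_c); lane «pcv-sawmu» a-p2 g22 — own result] -/
theorem exists_pos_tendsto_pow_mul_betaCount_even (hT : 2 ≤ T) :
    ∃ Λ : ℝ, 0 < Λ ∧ Tendsto (fun m : ℕ => hexCriticalFugacity ^ (2 * m) * ∑ l ∈ betaLen T (2 * m) (2 * m), stripYT T ^ topCnt T l)
      atTop (𝓝 Λ) := by
  obtain ⟨Λ, hΛ, hlim, -⟩ := exists_pos_tendsto_betaLenSum_even hT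
  refine ⟨Λ, hΛ, hlim.congr fun m => ?_⟩
  rw [betaLenSum, Finset.mul_sum]
  refine sum_congr rfl fun l hl => ?_
  rw [betaLen, mem_filter] at hl
  rw [hl.2]

/-- ★★ **Ratio law**: `bℓ_T(2m+2)(y_T) / bℓ_T(2m)(y_T) → 1` (`T ≥ 2`). [cite: Kesten1963SAW, §4 (ratio limit theorems for walk counts); BeatonBousquetMelouDeGierDuminilCopinGuttmann2014, Corollary 8; lane «pcv-sawmu» a-p2 g22 — own result] -/
theorem tendsto_betaLenSum_succ_div (hT : 2 ≤ T) :
    Tendsto (fun m : ℕ => betaLenSum T (2 * (m + 1)) (stripYT T) / betaLenSum T (2 * m) (stripYT T)) atTop (𝓝 1) := by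
  obtain ⟨Λ, hΛ, hlim, -⟩ := exists_pos_tendsto_betaLenSum_even hT
  have h := (hlim.comp (tendsto_add_atTop_nat 1)).div hlim hΛ.ne'
  rw [div_self hΛ.ne'] at h
  exact h

end Law

end HV

end Literature.Probability.RandomPlanarGeometry.SAW
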